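import Summits.ABC.ABC.Theses.CuspFieldPencil
import Summits.ABC.ABC.Theorems.CuspFieldPencilGoldenFromNFPencil
import Summits.ABC.ABC.Theorems.CuspFieldPencilNFPencilOfScoones
import Literature.NumberTheory.DiophantineGeometry.AbcScoones2021NumberFields

/-! Sketch (planner, stub-ideation k3): helper-lemma SIGNATURES for `stub_conjugateCuspTriple`
(crux stmt-ABC-26026 `GoldenCuspShadow`). Statements only; `sorry` bodies; elaboration check. -/

namespace Summit.ABC.ABC.Cruxes.GoldenCuspShadow.ConjugateViaNFPencil

open NumberField UniqueFactorizationMonoid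

/-- The registered stub signature, verbatim (payload.stub.signature). -/
def SigStubConjugateCuspTriple : Prop :=
  ∀ ε : ℝ, 0 < ε → ∃ κ : ℝ, ∀ u w : ℤ, IsCoprime u w → u * w * (u ^ 2 - 11 * u * w - w ^ 2) ≠ 0 → Real.log (max (|(u : ℝ)|) (|(w : ℝ)|)) ≤ κ * (((UniqueFactorizationMonoid.radical (u * w * (u ^ 2 - 11 * u * w - w ^ 2))).natAbs : ℕ) : ℝ) ^ (ε : ℝ) * ((((UniqueFactorizationMonoid.radical (u ^ 2 - 11 * u * w - w ^ 2)).natAbs : ℕ) : ℝ) ^ (2 / 3 : ℝ) * (min (((UniqueFactorizationMonoid.radical u).natAbs : ℕ) : ℝ) (((UniqueFactorizationMonoid.radical w).natAbs : ℕ) : ℝ)) ^ (2 / 3 : ℝ))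

/-! ### H1 ring identities: the two conjugate sub-pencils {x₊, x₋, w} and {x₊, x₋, u} -/

/-- H1w: `x₊ · x₋ · w = Q · w`, `Q = u² − 11uw − w²` (θ² = θ + 1, β₂ = −3 − 5θ = −φ⁵, β₃ = −8 + 5θ = φ⁻⁵). -/
theorem prod_forms_w {R : Type*} [CommRing R] (θ u w β₂ β₃ : R) (h₂ : β₂ = -3 - 5 * θ)
    (h₃ : β₃ = -8 + 5 * θ) (hθ : θ * θ = θ + 1) :
    ∏ i : Fin 3, ((![1, 1, 0] : Fin 3 → R) i * u + (![β₂, β₃, 1] : Fin 3 → R) i * w) =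
      (u ^ 2 - 11 * u * w - w ^ 2) * w := by
  sorry

/-- H1u: `x₊ · x₋ · u = Q · u`. -/
theorem prod_forms_u {R : Type*} [CommRing R] (θ u w β₂ β₃ : R) (h₂ : β₂ = -3 - 5 * θ)
    (h₃ : β₃ = -8 + 5 * θ) (hθ : θ * θ = θ + 1) :
    ∏ i : Fin 3, ((![1, 1, 1] : Fin 3 → R) i * u + (![β₂, β₃, 0] : Fin 3 → R) i * w) =
      (u ^ 2 - 11 * u * w - w ^ 2) * u := by
  sorry

/-! ### H2 pairwise non-proportionality of the two form triples -/

theorem nonprop_w {R : Type*} [CommRing R] [Nontrivial R] {β₂ β₃ : R} (h23 : β₂ ≠ β₃) :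
    ∀ i j : Fin 3, i ≠ j →
      (![1, 1, 0] : Fin 3 → R) i * (![β₂, β₃, 1] : Fin 3 → R) j ≠
        (![1, 1, 0] : Fin 3 → R) j * (![β₂, β₃, 1] : Fin 3 → R) i := by
  sorry

theorem nonprop_u {R : Type*} [CommRing R] {β₂ β₃ : R} (h23 : β₂ ≠ β₃) (h2 : β₂ ≠ 0)
    (h3 : β₃ ≠ 0) :
    ∀ i j : Fin 3, i ≠ j →
      (![1, 1, 1] : Fin 3 → R) i * (![β₂, β₃, 0] : Fin 3 → R) j ≠
        (![1, 1, 1] : Fin 3 → R) j * (![β₂, β₃, 0] : Fin 3 → R) i := by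
  sorry

/-! ### H3 norm bookkeeping in a quadratic field containing θ (only ℚ(√5)):
`G(x₊)·G(x₋)·G(w) ≤ N(5√5) · rad(Q)² · rad(w)²` — NO prime-splitting lemma needed:
`N(rad x₊)·N(rad x₋) = N(rad x₊ ⊔ rad x₋)·N(rad(Q𝓞_K))` (landed `absNorm_radical_mul_absNorm_radical`),
`5√5 ∈ (x₊, x₋)` (landed `sqrtFive_mem_sup`), `N(rad(n𝓞_K)) ≤ rad(n)²` (landed `absNorm_radical_span_intCast_le`). -/
theorem absNorm_prod_three_le_w (K : Type*) [Field K] [NumberField K] (θ β₂ β₃ : 𝓞 K)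
    (h₂ : β₂ = -3 - 5 * θ) (h₃ : β₃ = -8 + 5 * θ) (hθ : θ * θ = θ + 1)
    (hK : Module.finrank ℚ K = 2) {u w : ℤ} (hcop : IsCoprime u w) (hw : w ≠ 0)
    (hQ : u ^ 2 - 11 * u * w - w ^ 2 ≠ 0) :
    ∏ i : Fin 3, Ideal.absNorm (Ideal.span {(![1, 1, 0] : Fin 3 → 𝓞 K) i * (u : 𝓞 K) +
        (![β₂, β₃, 1] : Fin 3 → 𝓞 K) i * (w : 𝓞 K)}).radical ≤
      Ideal.absNorm (Ideal.span {(5 * (2 * θ - 1) : 𝓞 K)}) *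
        ((radical (u ^ 2 - 11 * u * w - w ^ 2)).natAbs ^ 2 * (radical w).natAbs ^ 2) := by
  sorry

theorem absNorm_prod_three_le_u (K : Type*) [Field K] [NumberField K] (θ β₂ β₃ : 𝓞 K)
    (h₂ : β₂ = -3 - 5 * θ) (h₃ : β₃ = -8 + 5 * θ) (hθ : θ * θ = θ + 1)
    (hK : Module.finrank ℚ K = 2) {u w : ℤ} (hcop : IsCoprime u w) (hu : u ≠ 0)
    (hQ : u ^ 2 - 11 * u * w - w ^ 2 ≠ 0) :
    ∏ i : Fin 3, Ideal.absNorm (Ideal.span {(![1, 1, 1] : Fin 3 → 𝓞 K) i * (u : 𝓞 K) +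
        (![β₂, β₃, 0] : Fin 3 → 𝓞 K) i * (w : 𝓞 K)}).radical ≤
      Ideal.absNorm (Ideal.span {(5 * (2 * θ - 1) : 𝓞 K)}) *
        ((radical (u ^ 2 - 11 * u * w - w ^ 2)).natAbs ^ 2 * (radical u).natAbs ^ 2) := by
  sorry

/-! ### H4 real arithmetic: exponent `1/3 + ε/2` on `C₀·A²·B²` ↦ `R^ε · A^{2/3} · B^{2/3}` using `A·B ≤ R` -/
theorem real_step_third {L C ε : ℝ} {P C₀ A B R : ℕ} (hε : 0 < ε)
    (hL : L ≤ C * (P : ℝ) ^ (1 / (3 : ℝ) + ε / 2)) (hP : P ≤ C₀ * (A ^ 2 * B ^ 2))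
    (hAB : A * B ≤ R) :
    L ≤ (max C 0 * (C₀ : ℝ) ^ (1 / (3 : ℝ) + ε / 2)) * (R : ℝ) ^ (ε : ℝ) *
      ((A : ℝ) ^ (2 / 3 : ℝ) * (B : ℝ) ^ (2 / 3 : ℝ)) := by
  sorry

/-! ### H5 the minimum: two one-letter bounds ⇒ the `min(rad u, rad w)^{2/3}` bound -/
theorem min_combine {L κ₁ κ₂ X A a b : ℝ} (hX : 0 ≤ X) (hA : 0 ≤ A) (ha : 0 ≤ a) (hb : 0 ≤ b)
    (h₁ : L ≤ κ₁ * X * (A * a ^ (2 / 3 : ℝ))) (h₂ : L ≤ κ₂ * X * (A * b ^ (2 / 3 : ℝ))) :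
    L ≤ max κ₁ κ₂ * X * (A * (min a b) ^ (2 / 3 : ℝ)) := by
  sorry

/-! ### Assembly -/

/-- A: the stub from the route's parametric crux `NFPencilBound` (k = 3, K = ℚ(√5) = `QuadraticAlgebra ℚ 1 1`,
forms {x₊, x₋, w} and {x₊, x₋, u}); pattern of the landed `goldenFromNFPencil_proof` (k = 4). Unconditional. -/
theorem stub_conjugateCuspTriple_of_nfPencilBound
    (hNF : Summit.ABC.ABC.Theses.CuspFieldPencil.NFPencilBound) : SigStubConjugateCuspTriple := by
  sorry

/-- B: hence PROVED-MOD-FACT from Scoones 2021 via the landed `nfPencilBound_of_scoones2021`. -/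
theorem stub_conjugateCuspTriple_of_scoones2021
    (hS : Literature.NumberTheory.DiophantineGeometry.scoones2021_abcNumberField_classNumberOne) :
    SigStubConjugateCuspTriple :=
  stub_conjugateCuspTriple_of_nfPencilBound (Summit.ABC.ABC.Theorems.nfPencilBound_of_scoones2021 hS)

end Summit.ABC.ABC.Cruxes.GoldenCuspShadow.ConjugateViaNFPencil
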